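import Mathlib
import Summits.NavierStokesRegularity.NavierStokesRegularity.Theorems.AffineBernoulliAxisymDecayingSwirlLiouvilleFlow
import Literature.Analysis.FluidPDE.SelfSimilarEulerSwirlingFixedPoint
import Literature.Analysis.FluidPDE.DecayingSelfSimilarEulerProfile
import Literature.Analysis.FluidPDE.AxisymNoSwirlVorticity
import Literature.Analysis.FluidPDE.CurlFreeLiouville
import Summits.NavierStokesRegularity.NavierStokesRegularity.Theses.AffineBernoulli
import HarnessLib

/-!
# `AffineBernoulli.AxisymDecayingSwirlLiouville` — the Pomeau–Le Berre case of the Euler–Leray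
  Liouville problem (route `AffineBernoulli`, item stmt-NavierStokesRegularity-13905, support)

**Statement.** An axisymmetric Euler–Leray profile `W ∈ 𝓔½` — `W ∈ C²(ℝ³)` divergence free,
`P ∈ C¹`, `½W + DW[½y + W] + ∇P = 0`, `‖W y‖ ≤ C(1+‖y‖)⁻¹`, `‖DW y‖ ≤ C((1+‖y‖)²)⁻¹`, equivariant
under the rotations about the `x₂`-axis — whose swirl `Γ = x₀W₁ − x₁W₀` tends to `0` at infinity is
identically zero.

PROOF (the item's plan; arXiv:1901.09426 §2.3). `V = ½y + W` is `C¹`, globally Lipschitz, axisymmetric;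
its flow `Ψ` (`Literature.Analysis.ODE.lipschitzFlow`) is complete and expands volume (`div V = 3/2`).
(1) SWIRL: `DΓ(y)[V y] = ⟪Jy, −½W − ∇P⟫ + ⟪J(½y + W), W⟫ = −∂_θP = 0` (`fderiv_swirl_apply`, the pressure
of an axisymmetric profile is an axisymmetric scalar — `isAxisymmetricScalar_pressure`), so `Γ` is a first
integral tending to `0` at infinity, hence `Γ ≡ 0` by `similarityFirstIntegralRigidity_zero` (proved
here: orbits outside a ball escape, the bounded forward-invariant set is closed and Lebesgue-null by
Liouville, the basin of infinity is dense; the general-centre twin `similarityFirstIntegralRigidity` is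
the helper file `AffineBernoulliEulerLerayLiouvilleFirstIntegralRigidity`, not imported).
(2) VORTICITY: with no swirl `curl W = η • J`, `η` continuous (`curl_eq_hadamardQuotFst_smul_rotGen`);
the identity `DΩ·V − DW·Ω = −Ω` (`IsSelfSimilarEulerProfile.vorticity_eq_sub_form`) gives
`DΨ_T(x)Ω(x) = e^{3T/2}Ω(Ψ_T x)` (`DecayFlux.fderiv_flow_apply_eq_exp_smul`) and the flow commutes
with rotations (`AxisymFlow.fderiv_flow_rotGen`: `DΨ_T(x)(Jx) = J(Ψ_T x)`), so
`η(Ψ_{−T}x) = e^{3T/2}η(x)` off the axis while backward orbits stay bounded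
(`SimilarityFlow.norm_sq_flow_le_of_nonpos_zero`): `η ≡ 0`, `curl W ≡ 0`.
(3) A bounded curl- and divergence-free `C²` field is constant
(`eq_of_curl_eq_zero_of_isDivFree_of_bounded`); the decay makes the constant `0`.

HONEST FRAMING: a Liouville theorem about HYPOTHETICAL axisymmetric self-similar Euler profiles
(the Pomeau–Le Berre scenario); nothing here bears on the regularity problem itself.
-/

noncomputable section

set_option linter.dupNamespace false

namespace Summit.NavierStokesRegularity.NavierStokesRegularity.Theorems

open Set Function Filter Topology MeasureTheory Metric
open scoped NNReal ENNReal ContDiff RealInnerProductSpace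
open Literature.Analysis.ODE Literature.Analysis.FluidPDE

namespace SimilarityFlow

/-- The centred similarity field `y ↦ ½y + W y` has derivative `½·id + DW(y)`. -/
theorem hasFDerivAt_half_add {W : EuclideanSpace ℝ (Fin 3) → EuclideanSpace ℝ (Fin 3)}
    (hW : Differentiable ℝ W) (y : EuclideanSpace ℝ (Fin 3)) :
    HasFDerivAt (fun y => (1 / 2 : ℝ) • y + W y)
      ((1 / 2 : ℝ) • ContinuousLinearMap.id ℝ (EuclideanSpace ℝ (Fin 3)) + fderiv ℝ W y) y :=
  ((hasFDerivAt_id y).const_smul (1 / 2 : ℝ)).add (hW y).hasFDerivAt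

/-- The centred similarity field is globally `(½ + C)`-Lipschitz when `‖DW‖ ≤ C((1+‖y‖)²)⁻¹`. -/
theorem lipschitzWith_half_add {W : EuclideanSpace ℝ (Fin 3) → EuclideanSpace ℝ (Fin 3)} {C : ℝ}
    (hC : 0 ≤ C) (hW : Differentiable ℝ W) (hDW : ∀ y, ‖fderiv ℝ W y‖ ≤ C * ((1 + ‖y‖) ^ 2)⁻¹) :
    LipschitzWith (Real.toNNReal (1 / 2 + C)) fun y => (1 / 2 : ℝ) • y + W y := by
  refine lipschitzWith_of_nnnorm_fderiv_le (fun y => (hasFDerivAt_half_add hW y).differentiableAt)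
    fun y => ?_
  rw [(hasFDerivAt_half_add hW y).fderiv, ← NNReal.coe_le_coe, coe_nnnorm,
    Real.coe_toNNReal _ (by positivity)]
  have h1 : ‖fderiv ℝ W y‖ ≤ C := by
    refine (hDW y).trans ?_
    have h2 : (1 : ℝ) ≤ (1 + ‖y‖) ^ 2 := by nlinarith [norm_nonneg y]
    calc C * ((1 + ‖y‖) ^ 2)⁻¹ ≤ C * 1 := mul_le_mul_of_nonneg_left (inv_le_one_of_one_le₀ h2) hC
      _ = C := mul_one C
  calc ‖(1 / 2 : ℝ) • ContinuousLinearMap.id ℝ (EuclideanSpace ℝ (Fin 3)) + fderiv ℝ W y‖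
      ≤ ‖(1 / 2 : ℝ) • ContinuousLinearMap.id ℝ (EuclideanSpace ℝ (Fin 3))‖ + ‖fderiv ℝ W y‖ :=
        norm_add_le _ _
    _ ≤ 1 / 2 + C := by
        refine add_le_add ?_ h1
        rw [norm_smul, Real.norm_eq_abs, abs_of_pos (by norm_num : (0 : ℝ) < 1 / 2)]
        nlinarith [ContinuousLinearMap.norm_id_le (𝕜 := ℝ) (E := EuclideanSpace ℝ (Fin 3))]

end SimilarityFlow

namespace DecayFlux

variable {E : Type*} [NormedAddCommGroup E] [NormedSpace ℝ E] [FiniteDimensional ℝ E]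
  [CompleteSpace E] [MeasurableSpace E] [BorelSpace E]

/-- **An expanding flow has no bounded forward-invariant set of positive measure** (Liouville): for
`g ∈ C¹` globally Lipschitz with constant divergence `tr Dg ≡ d > 0` and a measurable bounded `s` with
`Ψ_T '' s ⊆ s` for some `T > 0`, `μ s = 0` — the area formula gives `μ (Ψ_T '' s) = e^{dT} μ s`.
[folklore] -/
theorem measure_eq_zero_of_flow_invariant_bounded (μ : Measure E) [μ.IsAddHaarMeasure]
    {g : E → E} {K : ℝ≥0} (hK : LipschitzWith K g) (hg : ContDiff ℝ 1 g) {d : ℝ} (hd : 0 < d)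
    (hdiv : ∀ y, LinearMap.trace ℝ E (fderiv ℝ g y : E →ₗ[ℝ] E) = d) {T : ℝ} (hT : 0 < T)
    {s : Set E} (hs : MeasurableSet s) {x₀ : E} {R : ℝ} (hbdd : s ⊆ closedBall x₀ R)
    (hsub : (fun q => lipschitzFlow hK q T) '' s ⊆ s) : μ s = 0 := by
  have hfin : μ s ≠ ⊤ := (lt_of_le_of_lt (measure_mono hbdd) measure_closedBall_lt_top).ne
  choose J hJ hdet using fun x => exists_hasFDerivAt_flow_det_eq_exp hK hg hdiv hT.le x
  have harea := lintegral_abs_det_fderiv_eq_addHaar_image μ hs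
    (fun x _ => (hJ x).hasFDerivWithinAt) (injective_flow_slice hK T).injOn
  simp only [hdet, abs_of_pos (Real.exp_pos _), setLIntegral_const] at harea
  by_contra h0
  have h2 : ENNReal.ofReal (Real.exp (d * T)) * μ s ≤ μ s := harea ▸ measure_mono hsub
  have hgt : (1 : ℝ≥0∞) < ENNReal.ofReal (Real.exp (d * T)) := by
    rw [← ENNReal.ofReal_one, ENNReal.ofReal_lt_ofReal_iff (Real.exp_pos _)]
    exact Real.one_lt_exp_iff.2 (mul_pos hd hT)
  have h3 : (1 : ℝ≥0∞) * μ s < ENNReal.ofReal (Real.exp (d * T)) * μ s :=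
    (ENNReal.mul_lt_mul_iff_left h0 hfin).2 hgt
  rw [one_mul] at h3
  exact absurd h2 (not_le.2 h3)

end DecayFlux

open Literature.Analysis.FluidPDE in
/-- **First integrals of the centred similarity flow are determined at infinity.** For `W ∈ C¹`,
divergence free, with `‖W y‖ ≤ C(1+‖y‖)⁻¹` and `‖DW y‖ ≤ C((1+‖y‖)²)⁻¹`, every differentiable first
integral `f` of `V = ½y + W` (`Df(y)[V y] = 0`) which tends to `h` at infinity is identically `h`: the
flow of `V` is complete, orbits outside the ball `‖y‖² ≤ 2C + 1` run to infinity, and the bounded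
forward-invariant set is closed and Lebesgue-null (`div V = 3/2`), so the basin of infinity is dense.
(Centred twin of `similarityFirstIntegralRigidity`, stub S1 of crux stmt-13660.) [folklore] -/
theorem similarityFirstIntegralRigidity_zero :
    ∀ (W : EuclideanSpace ℝ (Fin 3) → EuclideanSpace ℝ (Fin 3)) (f : EuclideanSpace ℝ (Fin 3) → ℝ)
      (h : ℝ), ContDiff ℝ 1 W → Literature.Analysis.FluidPDE.VectorCalculus.IsDivFree W →
      (∃ C : ℝ, ∀ y, ‖W y‖ ≤ C * (1 + ‖y‖)⁻¹ ∧ ‖fderiv ℝ W y‖ ≤ C * ((1 + ‖y‖) ^ 2)⁻¹) →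
      Differentiable ℝ f → (∀ y, fderiv ℝ f y ((1 / 2 : ℝ) • y + W y) = 0) →
      Filter.Tendsto f (Filter.cocompact (EuclideanSpace ℝ (Fin 3))) (nhds h) →
      ∀ y, f y = h := by
  intro W f h hW hdiv hdec hf hfV hlim
  obtain ⟨C, hC⟩ := hdec
  have hC0 : 0 ≤ C := by
    have h0 := (hC 0).1
    simp only [norm_zero, add_zero, inv_one, mul_one] at h0
    exact (norm_nonneg _).trans h0
  obtain ⟨V, hV⟩ : ∃ V : EuclideanSpace ℝ (Fin 3) → EuclideanSpace ℝ (Fin 3),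
      V = fun y => (1 / 2 : ℝ) • y + W y := ⟨_, rfl⟩
  have hVx : ∀ x, V x = (1 / 2 : ℝ) • x + W x := fun x => by rw [hV]
  have hVC1 : ContDiff ℝ 1 V := by rw [hV]; exact (contDiff_id.const_smul _).add hW
  have hWd : Differentiable ℝ W := hW.differentiable (by simp)
  have hVd : ∀ y, HasFDerivAt V
      ((1 / 2 : ℝ) • ContinuousLinearMap.id ℝ (EuclideanSpace ℝ (Fin 3)) + fderiv ℝ W y) y := by
    intro y; rw [hV]; exact SimilarityFlow.hasFDerivAt_half_add hWd y
  have hVlip : LipschitzWith (Real.toNNReal (1 / 2 + C)) V := by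
    rw [hV]; exact SimilarityFlow.lipschitzWith_half_add hC0 hWd fun y => (hC y).2
  have hVdiv : ∀ y, LinearMap.trace ℝ _
      (fderiv ℝ V y : EuclideanSpace ℝ (Fin 3) →ₗ[ℝ] EuclideanSpace ℝ (Fin 3)) = 3 / 2 := by
    intro y
    rw [(hVd y).fderiv]
    have h1 : LinearMap.trace ℝ _
        (fderiv ℝ W y : EuclideanSpace ℝ (Fin 3) →ₗ[ℝ] EuclideanSpace ℝ (Fin 3)) = 0 := hdiv y
    have h2 : (((1 / 2 : ℝ) • ContinuousLinearMap.id ℝ (EuclideanSpace ℝ (Fin 3)) + fderiv ℝ W y :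
        EuclideanSpace ℝ (Fin 3) →L[ℝ] EuclideanSpace ℝ (Fin 3)) :
        EuclideanSpace ℝ (Fin 3) →ₗ[ℝ] EuclideanSpace ℝ (Fin 3))
        = (1 / 2 : ℝ) • LinearMap.id +
          (fderiv ℝ W y : EuclideanSpace ℝ (Fin 3) →ₗ[ℝ] EuclideanSpace ℝ (Fin 3)) := rfl
    rw [h2, map_add, map_smul, h1, LinearMap.trace_id, finrank_euclideanSpace_fin]
    norm_num
  have hconst : ∀ q t, f (lipschitzFlow hVlip q t) = f q := by
    intro q t
    have hF : ∀ s, HasDerivAt (fun s => f (lipschitzFlow hVlip q s)) 0 s := by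
      intro s
      have h1 := ((hf _).hasFDerivAt).comp_hasDerivAt s (hasDerivAt_lipschitzFlow hVlip q s)
      rw [hVx, hfV] at h1
      exact h1
    have h := is_const_of_deriv_eq_zero (fun s => (hF s).differentiableAt)
      (fun s => (hF s).deriv) t 0
    rwa [lipschitzFlow_zero] at h
  -- orbits outside the ball `‖y‖² ≤ 2C + 1` run to infinity, so `f = h` along them
  have hW0 : ∀ y, ‖W y‖ ≤ C * (1 + ‖y‖)⁻¹ := fun y => (hC y).1
  have hescape : ∀ q (t : ℝ), 2 * C + 1 < ‖lipschitzFlow hVlip q t‖ ^ 2 → f q = h := by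
    intro q t hqt
    obtain ⟨q', hq'⟩ : ∃ q', q' = lipschitzFlow hVlip q t := ⟨_, rfl⟩
    have htend : Tendsto (fun s : ℝ => lipschitzFlow hVlip q' s) atTop (cocompact _) := by
      refine tendsto_cocompact_of_tendsto_dist_comp_atTop (0 : EuclideanSpace ℝ (Fin 3)) ?_
      have h1 : Tendsto (fun s : ℝ => (‖q'‖ ^ 2 - 2 * C) * Real.exp s + 2 * C) atTop atTop := by
        refine tendsto_atTop_add_const_right _ _ ?_
        exact Tendsto.const_mul_atTop (by rw [hq']; linarith) Real.tendsto_exp_atTop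
      have h2 : Tendsto (fun s : ℝ => ‖lipschitzFlow hVlip q' s‖ ^ 2) atTop atTop := by
        refine tendsto_atTop_mono' atTop ?_ h1
        filter_upwards [eventually_ge_atTop (0 : ℝ)] with s hs
        linarith [SimilarityFlow.sub_mul_exp_le_of_nonneg_zero hVlip hVx hC0 hW0 q' hs]
      have h3 : Tendsto (fun s : ℝ => ‖lipschitzFlow hVlip q' s‖) atTop atTop := by
        have h4 := (tendsto_rpow_atTop (by norm_num : (0 : ℝ) < 1 / 2)).comp h2
        refine h4.congr fun s => ?_
        simp only [Function.comp_apply]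
        rw [← Real.sqrt_eq_rpow, Real.sqrt_sq (norm_nonneg _)]
      simpa [dist_eq_norm] using h3
    have h1 : Tendsto (fun s : ℝ => f (lipschitzFlow hVlip q' s)) atTop (𝓝 h) := hlim.comp htend
    have h2 : Tendsto (fun s : ℝ => f (lipschitzFlow hVlip q' s)) atTop (𝓝 (f q')) := by
      simp only [hconst]; exact tendsto_const_nhds
    have h3 : f q' = h := tendsto_nhds_unique h2 h1
    rwa [hq', hconst] at h3
  -- the bounded forward-invariant set is closed and null
  obtain ⟨Inv, hInv⟩ : ∃ Inv : Set (EuclideanSpace ℝ (Fin 3)),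
      Inv = {q | ∀ t : ℝ, 0 ≤ t → ‖lipschitzFlow hVlip q t‖ ^ 2 ≤ 2 * C + 1} := ⟨_, rfl⟩
  have hout : ∀ q, q ∉ Inv → f q = h := by
    intro q hq
    rw [hInv] at hq
    simp only [mem_setOf_eq, not_forall, not_le, exists_prop] at hq
    obtain ⟨t, -, ht⟩ := hq
    exact hescape q t ht
  have hclosed : IsClosed Inv := by
    have heq : Inv = ⋂ t : ℝ, ⋂ (_ : 0 ≤ t), {q | ‖lipschitzFlow hVlip q t‖ ^ 2 ≤ 2 * C + 1} := by
      rw [hInv]; ext q; simp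
    rw [heq]
    refine isClosed_iInter fun t => isClosed_iInter fun _ => ?_
    exact isClosed_le ((DecayFlux.continuous_flow_slice hVlip hVC1 t).norm.pow 2) continuous_const
  have hbdd : Inv ⊆ closedBall 0 (Real.sqrt (2 * C + 1)) := by
    intro q hq
    rw [hInv] at hq
    have h0 := hq 0 le_rfl
    rw [lipschitzFlow_zero] at h0
    rw [mem_closedBall, dist_zero_right, ← Real.sqrt_sq (norm_nonneg q)]
    exact Real.sqrt_le_sqrt h0
  have hsub : (fun q => lipschitzFlow hVlip q 1) '' Inv ⊆ Inv := by
    rintro _ ⟨q, hq, rfl⟩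
    rw [hInv] at hq ⊢
    intro t ht
    have h := hq (1 + t) (by linarith)
    rwa [lipschitzFlow_add] at h
  have hnull : volume Inv = 0 :=
    DecayFlux.measure_eq_zero_of_flow_invariant_bounded volume hVlip hVC1
      (by norm_num : (0 : ℝ) < 3 / 2) hVdiv one_pos hclosed.measurableSet hbdd hsub
  have hdense : Dense Invᶜ := by
    rw [← interior_eq_empty_iff_dense_compl]
    by_contra hne
    obtain ⟨x, hx⟩ := nonempty_iff_ne_empty.2 hne
    have hpos : 0 < volume (interior Inv) := isOpen_interior.measure_pos volume ⟨x, hx⟩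
    have hle : volume (interior Inv) ≤ volume Inv := measure_mono interior_subset
    rw [hnull] at hle
    exact absurd hle (not_le.2 hpos)
  have hfeq : f = fun _ => h :=
    Continuous.ext_on hdense hf.continuous continuous_const fun q hq => hout q hq
  intro y
  rw [hfeq]

/-- **Item `AffineBernoulli.AxisymDecayingSwirlLiouville` (stmt-NavierStokesRegularity-13905), the
Pomeau–Le Berre case.** An axisymmetric Euler–Leray profile `W ∈ 𝓔½` (`W ∈ C²` divergence free,
`P ∈ C¹`, `½W + DW[½y + W] + ∇P = 0`, `‖W‖ ≤ C(1+‖y‖)⁻¹`, `‖DW‖ ≤ C((1+‖y‖)²)⁻¹`) whose swirl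
`Γ = x₀W₁ − x₁W₀` tends to `0` at infinity vanishes identically. -/
theorem affineBernoulli_axisymDecayingSwirlLiouville_proof :
    Theses.AffineBernoulli.AxisymDecayingSwirlLiouville := by
  intro W P hax hW2 hP1 hdiv heq hdec hswirl y₀
  have hax' : IsAxisymmetric W := hax
  obtain ⟨C, hC⟩ := hdec
  have hC0 : 0 ≤ C := by
    have h0 := (hC 0).1
    simp only [norm_zero, add_zero, inv_one, mul_one] at h0
    exact (norm_nonneg _).trans h0
  have hWbd : ∀ y, ‖W y‖ ≤ C := fun y => ((hC y).1).trans
    (mul_le_of_le_one_right hC0 (inv_le_one_of_one_le₀ (by linarith [norm_nonneg y])))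
  have hW1 : ContDiff ℝ 1 W := hW2.of_le (by norm_num)
  have hWd : Differentiable ℝ W := hW1.differentiable (by simp)
  -- the profile structure at `γ = ½`, `c = 0`
  have hprof : IsSelfSimilarEulerProfile (1 / 2 : ℝ) 0 W P := by
    refine ⟨hW2, hP1, fun y => ?_, hdiv⟩
    rw [sub_zero, show (1 - 1 / 2 : ℝ) = 1 / 2 by norm_num]
    exact heq y
  have hP : IsAxisymmetricScalar P :=
    hprof.isAxisymmetricScalar_pressure hax' ⟨rfl, rfl⟩
  obtain ⟨V, hV⟩ : ∃ V : EuclideanSpace ℝ (Fin 3) → EuclideanSpace ℝ (Fin 3),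
      V = fun y => (1 / 2 : ℝ) • y + W y := ⟨_, rfl⟩
  have hVx : ∀ x, V x = (1 / 2 : ℝ) • x + W x := fun x => by rw [hV]
  have hVx' : ∀ x, V x = (1 / 2 : ℝ) • (x - 0) + W x := fun x => by rw [hV, sub_zero]
  have hVC1 : ContDiff ℝ 1 V := by
    rw [hV]; exact (contDiff_id.const_smul _).add hW1
  have hVd : ∀ y, HasFDerivAt V
      ((1 / 2 : ℝ) • ContinuousLinearMap.id ℝ (EuclideanSpace ℝ (Fin 3)) + fderiv ℝ W y) y := by
    intro y; rw [hV]; exact SimilarityFlow.hasFDerivAt_half_add hWd y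
  have hVlip : LipschitzWith (Real.toNNReal (1 / 2 + C)) V := by
    rw [hV]; exact SimilarityFlow.lipschitzWith_half_add hC0 hWd fun y => (hC y).2
  have hVax : IsAxisymmetric V := by
    intro θ x
    rw [hVx, hVx, hax' θ x, ← rotZL_apply, ← rotZL_apply, ← rotZL_apply, map_add, map_smul]
  -- (A) the swirl is a first integral of `V`, hence vanishes
  have hsw : HasNoSwirl W := by
    have hGd : Differentiable ℝ (swirl W) := (contDiff_swirl hW1).differentiable (by simp)
    have hGV0 : ∀ y, fderiv ℝ (swirl W) y ((1 / 2 : ℝ) • (y - 0) + W y) = 0 := by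
      intro y
      have hDW : fderiv ℝ W y ((1 / 2 : ℝ) • (y - 0) + W y) =
          -((1 - 1 / 2 : ℝ) • W y) - gradient P y := by
        have h := hprof.profile_eq y
        rw [← sub_eq_zero]
        have : fderiv ℝ W y ((1 / 2 : ℝ) • (y - 0) + W y) - (-((1 - 1 / 2 : ℝ) • W y) - gradient P y)
            = (1 - 1 / 2 : ℝ) • W y + fderiv ℝ W y ((1 / 2 : ℝ) • (y - 0) + W y) + gradient P y := by
          abel
        rw [this, h]
      rw [fderiv_swirl_apply (hWd y), hDW, sub_zero, rotGen_add, rotGen_smul, inner_add_left,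
        inner_smul_left, inner_rotGen_self, inner_sub_right, inner_neg_right, inner_smul_right,
        hP.inner_rotGen_gradient (hprof.differentiable_pressure y)]
      simp only [conj_trivial]
      ring
    have hGV : ∀ y, fderiv ℝ (swirl W) y ((1 / 2 : ℝ) • y + W y) = 0 := fun y => by
      simpa only [sub_zero] using hGV0 y
    have hswirl' : Tendsto (swirl W) (cocompact (EuclideanSpace ℝ (Fin 3))) (𝓝 0) := hswirl
    exact similarityFirstIntegralRigidity_zero W (swirl W) 0 hW1 hdiv ⟨C, hC⟩ hGd hGV hswirl'
  -- (B) no swirl: `curl W = η • J` with `η` continuous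
  obtain ⟨η, hη⟩ : ∃ η : EuclideanSpace ℝ (Fin 3) → ℝ,
      η = hadamardQuotFst fun y => curl W y 1 := ⟨_, rfl⟩
  have hΩη : ∀ x, curl W x = η x • rotGen x := fun x => by
    rw [hη]; exact curl_eq_hadamardQuotFst_smul_rotGen hax' hsw hW2 x
  have hηc : Continuous η := by
    rw [hη]
    have hW2' : ContDiff ℝ ((0 + 1 : ℕ∞) + 1) W := by
      convert hW2 using 2
      norm_num
    exact (contDiff_hadamardQuotFst_curl (n := 0) hW2').continuous
  have hΩC1 : ContDiff ℝ 1 (curl W) := contDiff_curl (n := 1) (by exact_mod_cast hW2)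
  -- the commutation relation `DΩ·V = DV·Ω − (3/2)Ω`
  have hcomm : ∀ y, fderiv ℝ (curl W) y (V y) =
      fderiv ℝ V y (curl W y) + (-(3 / 2 : ℝ)) • curl W y := by
    intro y
    have hvort := hprof.vorticity_eq_sub_form y
    rw [hVx' y, (hVd y).fderiv]
    have happ : ((1 / 2 : ℝ) • ContinuousLinearMap.id ℝ (EuclideanSpace ℝ (Fin 3)) + fderiv ℝ W y)
        (curl W y) = (1 / 2 : ℝ) • curl W y + fderiv ℝ W y (curl W y) := rfl
    rw [sub_eq_iff_eq_add] at hvort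
    rw [happ, hvort]
    module
  -- transport: `η x · J(Ψ_T x) = e^{3T/2} η(Ψ_T x) · J(Ψ_T x)` for `T ≥ 0`
  have hkey : ∀ {T : ℝ}, 0 ≤ T → ∀ x,
      η x • rotGen (lipschitzFlow hVlip x T) =
        Real.exp (3 / 2 * T) • (η (lipschitzFlow hVlip x T) • rotGen (lipschitzFlow hVlip x T)) := by
    intro T hT x
    have h1 := DecayFlux.fderiv_flow_apply_eq_exp_smul hVlip hVC1 hΩC1 hcomm hT x
    rw [hΩη x, map_smul, AxisymFlow.fderiv_flow_rotGen hVlip hVC1 hVax T x, hΩη] at h1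
    rw [h1, show -(-(3 / 2 : ℝ) * T) = 3 / 2 * T by ring]
  -- hence `η = 0` off the axis
  have hηzero : ∀ x : EuclideanSpace ℝ (Fin 3), rotGen x ≠ 0 → η x = 0 := by
    intro x hJx
    by_contra hne
    have hpos : 0 < |η x| := abs_pos.2 hne
    obtain ⟨R₀, hR₀⟩ : ∃ R₀ : ℝ, ∀ t : ℝ, t ≤ 0 → ‖lipschitzFlow hVlip x t‖ ≤ R₀ := by
      refine ⟨Real.sqrt (2 * C + |‖x‖ ^ 2 - 2 * C|), fun t ht => ?_⟩
      have h := SimilarityFlow.norm_sq_flow_le_of_nonpos_zero hVlip hVx hC0 (fun y => (hC y).1) x ht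
      rw [← Real.sqrt_sq (norm_nonneg _)]
      exact Real.sqrt_le_sqrt h
    obtain ⟨M, hM⟩ := (isCompact_closedBall (0 : EuclideanSpace ℝ (Fin 3)) R₀).exists_bound_of_continuousOn
      hηc.continuousOn
    have hMx : ∀ T : ℝ, 0 ≤ T → Real.exp (3 / 2 * T) * |η x| ≤ M := by
      intro T hT
      have hz := hkey hT (lipschitzFlow hVlip x (-T))
      have hback : lipschitzFlow hVlip (lipschitzFlow hVlip x (-T)) T = x := by
        have h := lipschitzFlow_neg_lipschitzFlow hVlip x (-T)
        rwa [neg_neg] at h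
      rw [hback] at hz
      -- hz : η z • J x = exp(3T/2) • (η x • J x)
      have h2 : (η (lipschitzFlow hVlip x (-T)) - Real.exp (3 / 2 * T) * η x) • rotGen x = 0 := by
        rw [sub_smul, hz, smul_smul, sub_self]
      have h3 : η (lipschitzFlow hVlip x (-T)) = Real.exp (3 / 2 * T) * η x := by
        have := smul_eq_zero.1 h2
        rcases this with h4 | h4
        · linarith
        · exact absurd h4 hJx
      have h5 : ‖η (lipschitzFlow hVlip x (-T))‖ ≤ M :=
        hM _ (mem_closedBall_zero_iff.2 (hR₀ (-T) (by linarith)))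
      rw [h3, Real.norm_eq_abs, abs_mul, abs_of_pos (Real.exp_pos _)] at h5
      exact h5
    have hM0 : 0 ≤ M := by
      have h := hMx 0 le_rfl
      rw [mul_zero, Real.exp_zero, one_mul] at h
      exact hpos.le.trans h
    have hT0 : 0 ≤ M / |η x| := div_nonneg hM0 hpos.le
    have h1 := hMx (M / |η x|) hT0
    have h2 : 3 / 2 * (M / |η x|) + 1 ≤ Real.exp (3 / 2 * (M / |η x|)) := Real.add_one_le_exp _
    have h3 : (3 / 2 * (M / |η x|) + 1) * |η x| ≤ M :=
      (mul_le_mul_of_nonneg_right h2 hpos.le).trans h1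
    have h4 : (3 / 2 * (M / |η x|) + 1) * |η x| = 3 / 2 * M + |η x| := by
      field_simp
    rw [h4] at h3
    linarith
  have hcurl : ∀ x, curl W x = 0 := by
    intro x
    rw [hΩη x]
    by_cases hJ : rotGen x = 0
    · rw [hJ, smul_zero]
    · rw [hηzero x hJ, zero_smul]
  -- `W` is constant (div–curl Liouville for bounded fields) and decays: `W ≡ 0`
  have hWconst : ∀ x y, W x = W y := eq_of_curl_eq_zero_of_isDivFree_of_bounded hW2 hcurl hdiv hWbd
  obtain ⟨w, hw⟩ : ∃ w : EuclideanSpace ℝ (Fin 3), ‖w‖ = 1 := exists_norm_eq _ zero_le_one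
  have hle : ∀ n : ℕ, ‖W y₀‖ ≤ C * (1 / ((n : ℝ) + 1)) := by
    intro n
    have h := (hC ((n : ℝ) • w)).1
    rw [← hWconst y₀, norm_smul, hw, mul_one, Real.norm_eq_abs, Nat.abs_cast] at h
    rw [one_div, add_comm]
    exact h
  have hlim : Tendsto (fun n : ℕ => C * (1 / ((n : ℝ) + 1))) atTop (𝓝 0) := by
    simpa using tendsto_one_div_add_atTop_nhds_zero_nat.const_mul C
  have h0 : ‖W y₀‖ ≤ 0 := ge_of_tendsto' hlim hle
  exact norm_le_zero_iff.1 h0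

end Summit.NavierStokesRegularity.NavierStokesRegularity.Theorems

end
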